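import Literature.NumberTheory.EllipticCurves.Kato2004.EllipticUnitKummerCupMap
import HarnessLib

/-!
# Kato 2004 (Astérisque 295) (15.6.1)∘(15.12.1)∘15.14 — stage S5: the `T_pE`-adic classes `w_U = lim_k c_{U,k} ∈ H¹(K̄^U, T_pE)`
# of a unit tower on a Kummer frame at every layer, the Λ-adic class `𝐳 ∈ 𝐇¹_{K,Γ}(T_pE)` with `proj_n 𝐳 = w_{Gal(K̄/K_n)}`,
# and the `π`-DIVISIBILITY TEST `(φ|E[p^k])_* ∘ red_{p^k} ∘ φ_* = 0` (`φ ∘ φ = [m]`, `p^k ∣ m`)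

Topic `NumberTheory/EllipticCurves`, sub-directory `Kato2004` (namespace = path; decls under `KummerFrame.…`).  Definitions
with bodies and theorems: **no named fact is introduced** (D-0026); no instance, no notation, no `sorry`.  Number field `K`,
ANY elliptic `E : WeierstrassCurve K`, ANY prime `p`; NO complex multiplication inside.

Given a Kummer frame `F` and a unit tower `u` on it (`Kato2004/EllipticUnitKummerCupMap.lean`: the finite-level classes
`c_{U,k} = Cor_{V_s → U}(κ_{V_s}(z_s^{1/p^k}) ∪ e_k) ∈ H¹(U, E[p^k])`, `p_*`-compatible and integral), Rubin B.2.3 over `K`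
(`Kato2004/IwasawaH1ReductionNumberFieldSeparatedProofs.lean`: `H¹(U, T_pE) = lim←_k H¹(U, E[p^k])`) glues them, at
EVERY open `U ⊇ V_s`, into ONE class `w_U ∈ H¹(U, T_pE)` — Kato's image of the unit `z` of the layer `K̄^U ⊆ K(p^s𝔣)` under
`𝕌 ≅ 𝐇¹(ℤ_p(1))` (15.6.1) followed by the twist `⊗ γ` (15.12.1); the `w_U` are norm-compatible and integral (the (Z1)/(Z2)
clauses of `CM.EllipticZetaBody`), and on the cyclotomic layers `U = Gal(K̄/K_n)` they ARE the layer components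
`IK.proj n 𝐳` of the Λ-adic class `𝐳` of T1b-2 (`existsUnique_iwasawaClass`) — the shape of the field `euK_spec` of
`GenusSeven.PinnedKatoGenusFrame` («`IK.proj n (euK 𝔟) = w (Gal(K̄/Kℚ_n))`»).

* §1 `classAtAny` (the finite-level class on `U ⊇ V_s` at EVERY level `k`, auxiliary `s` chosen ≥ `k`), `_eq_classAt`,
  `reduceTorsionH1_classAtAny`, `layerCores_classAtAny`, `classAtAny_mem_integralH1K`.
* §2 ★ `tateClassAt (F) (u) U hU : H1 (tateRepK E p) U` (`∃!`, `existsUnique_tateClassAt`), `reduceH1PkK_tateClassAt`,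
  `eq_tateClassAt_of_forall_reduceH1PkK_eq`, ★ `layerCores_tateClassAt` (norm compatibility = (Z1)), ★
  `tateClassAt_mem_integralH1K` ((Z2)), and the total function `tateClass (F) (u) : ∀ U, H1 (tateRepK E p) U` (`0`
off the tower)
  — the `w` argument of `CM.EllipticZetaBody`.
* §3 ★ `iwasawaClass (F) (u) κ hV IK : IK.H` (`:= choose` of `existsUnique_iwasawaClass`), `reduceH1PkK_proj_iwasawaClass`,
  `eq_iwasawaClass`, ★★ `proj_iwasawaClass : IK.proj n 𝐳 = tateClassAt (Gal(K̄/K_n))` and `proj_iwasawaClass_eq_tateClass`.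
* §4 (any `K`-isogeny `φ : E → E` with `φ ∘ φ = [m]`, `p^k ∣ m`; at the consumer `φ = √−7`, `m = −7`, `p^k = 7`)
  ★ `mapH1AddHom_reduceH1PkK_isogenyLayerMapK_eq_zero` (`(φ|E[p^k])_* red_{p^k} (φ_* c) = 0`) and, on the pinned datum,
  ★★ `not_mem_range_isogenyMap_of_ne_zero`: if `(φ|E[p^k])_* red_{p^k} (IK.proj n x) ≠ 0` for some `n`, then
  `x ∉ Set.range (IK.isogenyMap φ IK hγ)` — the EXACT shape `euK 𝔞 ∉ Set.range (IK.isogenyMap φ IK hγK)` in which the pinned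
  frame reads the field `EU_not_mem_of_residue` (the remaining input, «`red′(euK) ≠ 0` from the genus residue», is the value
  side: Prop. 15.9 / (15.12.2) on these classes, next file).

Dictionary `ℚ ↔ K`: none (no `ℚ`-side Kummer construction exists; reduction tower = T2a/T2b).  GENERALISE-VS-DUPLICATE (director
(729)): new notions `classAtAny`, `tateClassAt`, `tateClass`, `iwasawaClass`; engines BY NAME: `classAt`/`cycClass` &
API (T1b-2),
`existsUnique_reduceH1PkK_eq_of_compatible` (T2b-1), `reduceH1PkK_layerCores`, `mapH1AddHom_reduceH1PkK_isogeny` (T2a),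
`mem_integralH1K_iff_forall_reduceH1PkK_mem` (T2b-2), `IwasawaH1DataOver.proj_isogenyMap`
(`IwasawaCohomologyNumberFieldIsogeny`);
nothing re-declared.  CONSUMER BY NAME (director (721)/(739)(3)): fields `euK`/`euK_spec`/`EU_eq` and
`EU_not_mem_of_residue : GenusResidueNonzeroShape d → ¬ ∃ y ∈ frame.HS, frame.EU 𝔞 = π • y` of
`Summit.BirchSwinnertonDyer.Rank1Residual.Additive.GenusSeven.{PinnedKatoGenusFrame, KatoGenusFrame}`: `euK 𝔞 := iwasawaClass`
(§3), `w := tateClass` in `euK_spec` (§2–§3), and `EU_not_mem_of_residue` through §4.  HONEST FRAMING: Galois-cohomological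
bookkeeping; no CM theory, no L-value, nothing about any particular curve; no summit statement is proved.

## References

* [Kato2004Asterisque] K. Kato, Astérisque 295 (2004), §8.2 (pp. 180–181), §12.2 (p. 220), §15.5–(15.6.1) (p. 253), (15.12.1)
  (p. 263), 15.14 (p. 264: "`O_λ[[G′_∞]]`-modules" — the CM action on `𝐇¹`).
* [Rubin2000] K. Rubin, *Euler Systems* (2000), App. B Prop. B.2.3, §B.3; III §3.3–3.4.
* [SilvermanAEC2009] J. H. Silverman, *The Arithmetic of Elliptic Curves* (2009), III.6.1, III.7.4 (`φ̂ ∘ φ = [deg φ]`).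
* [NeukirchSchmidtWingberg2008] NSW (2008), I §5 Prop. 1.5.3 (iii).
-/

noncomputable section

open scoped NumberField
open Field IsDedekindDomain
open Literature.NumberTheory.GaloisRepresentations
open Literature.NumberTheory.EllipticCurves
open Literature.NumberTheory.EllipticCurves.Kato2004.CM (tateRepK integralH1K mem_integralH1K_iff)
open WeierstrassCurve (geomPoints geomTorsion)

namespace Literature.NumberTheory.EllipticCurves.Kato2004

namespace KummerFrame

variable {K : Type} [Field K] [NumberField K] {E : WeierstrassCurve K} {p : ℕ} [Fact p.Prime]
  (F : KummerFrame E p) (u : F.UnitTower)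

/-! ## §1 The finite-level classes on `U ⊇ V_s` at every level `k` -/

/-- The class `c_{U,k} ∈ H¹(U, E[p^k])` on an open `U` containing SOME Kummer level, at EVERY `k` (auxiliary level
`max s₀ k` for the witnessed `s₀`; independent of it by `classAt_eq_classAt`). [cite: Kato2004Asterisque, (15.6.1)
(p. 253) and (15.12.1) (p. 263)] -/
def classAtAny (U : Subgroup (absoluteGaloisGroup K)) (hU : ∃ s, F.V s ≤ U) (k : ℕ) :
    H1 (E.torsionGaloisModule ((p : ℤ) ^ k)) U :=
  F.classAt u U (max (Classical.choose hU) k) k (le_max_right _ _)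
    ((F.V_anti (le_max_left _ _)).trans (Classical.choose_spec hU))

/-- `classAtAny` is `classAt` for any admissible auxiliary level. [cite: Kato2004Asterisque, §15.5 (p. 253)] -/
theorem classAtAny_eq_classAt (U : Subgroup (absoluteGaloisGroup K)) (hU : ∃ s, F.V s ≤ U) (k s : ℕ) (hks : k ≤ s)
    (hsU : F.V s ≤ U) : F.classAtAny u U hU k = F.classAt u U s k hks hsU :=
  F.classAt_eq_classAt u U k _ _ _ _

/-- `p_* c_{U,k+1} = c_{U,k}`. [cite: Kato2004Asterisque, §8.2 (p. 181)] [cite: Rubin2000, App. B Prop. B.2.3] -/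
theorem reduceTorsionH1_classAtAny (U : Subgroup (absoluteGaloisGroup K)) (hU : ∃ s, F.V s ≤ U) (k : ℕ) :
    E.reduceTorsionH1 p k U (F.classAtAny u U hU (k + 1)) = F.classAtAny u U hU k := by
  rw [classAtAny, F.reduceTorsionH1_classAt,
    F.classAtAny_eq_classAt u U hU k _ ((Nat.le_succ k).trans (le_max_right _ _))]

/-- `Cor_{U → U'} c_{U,k} = c_{U',k}`. [cite: Kato2004Asterisque, §15.5 (p. 253)] [cite: NeukirchSchmidtWingberg2008,
I §5 Prop. 1.5.3 (iii)] -/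
theorem layerCores_classAtAny {U U' : Subgroup (absoluteGaloisGroup K)} (hUU' : U ≤ U')
    (hUo : IsOpen (U : Set (absoluteGaloisGroup K))) (hU : ∃ s, F.V s ≤ U) (hU' : ∃ s, F.V s ≤ U') (k : ℕ) :
    CM.layerCores (E.torsionGaloisModule ((p : ℤ) ^ k)) hUU' hUo (F.classAtAny u U hU k) = F.classAtAny u U' hU' k := by
  rw [classAtAny, F.layerCores_classAt, F.classAtAny_eq_classAt u U' hU' k _ (le_max_right _ _)]

/-- `c_{U,k} ∈ H¹(O_{K̄^U}[1/p], E[p^k])`. [cite: Kato2004Asterisque, §15.5–15.6 (p. 253) and §8.2 (pp. 180–181)] -/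
theorem classAtAny_mem_integralH1K (U : Subgroup (absoluteGaloisGroup K)) (hU : ∃ s, F.V s ≤ U) (k : ℕ) :
    F.classAtAny u U hU k ∈ integralH1K (E.torsionGaloisModule ((p : ℤ) ^ k)) p U :=
  F.classAt_mem_integralH1K u _ _ _ _ _

/-! ## §2 The `T_pE`-adic class `w_U ∈ H¹(U, T_pE)` -/

variable [E.IsElliptic] [ContinuousSMul ℤ_[p] (E.tateModule p)]

/-- **`∃!` — the `p_*`-compatible family `(c_{U,k})_k` is the family of reductions of a unique class of `H¹(U, T_pE)`** (Rubin
B.2.3 over `K`, `existsUnique_reduceH1PkK_eq_of_compatible`). [cite: Rubin2000, App. B Prop. B.2.3] [cite: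
Kato2004Asterisque, §8.2 (p. 181)] -/
theorem existsUnique_tateClassAt (U : Subgroup (absoluteGaloisGroup K)) (hU : ∃ s, F.V s ≤ U) :
    ∃! w : H1 (tateRepK E p) U, ∀ k, reduceH1PkK E p k U w = F.classAtAny u U hU k :=
  existsUnique_reduceH1PkK_eq_of_compatible E p U _ fun k ↦ F.reduceTorsionH1_classAtAny u U hU k

/-- ★ **The `T_pE`-adic class `w_U ∈ H¹(K̄^U, T_pE)` of the unit tower at the layer cut out by `U ⊇ V_s`** — Kato's image of the
unit under `𝕌 ≅ 𝐇¹(ℤ_p(1))` (15.6.1) followed by `⊗ γ` (15.12.1), at finite level: the unique class with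
`red_{p^k} w_U = c_{U,k} = Cor_{V_s → U}(κ_{V_s}(z_s^{1/p^k}) ∪ e_k)` for all `k`.
[cite: Kato2004Asterisque, (15.6.1) (p. 253) and (15.12.1) (p. 263)] [cite: Rubin2000, App. B Prop. B.2.3] -/
def tateClassAt (U : Subgroup (absoluteGaloisGroup K)) (hU : ∃ s, F.V s ≤ U) : H1 (tateRepK E p) U :=
  (F.existsUnique_tateClassAt u U hU).exists.choose

/-- The defining property: `red_{p^k} w_U = c_{U,k}`. [cite: Kato2004Asterisque, §8.2 (p. 181)] -/
theorem reduceH1PkK_tateClassAt (U : Subgroup (absoluteGaloisGroup K)) (hU : ∃ s, F.V s ≤ U) (k : ℕ) :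
    reduceH1PkK E p k U (F.tateClassAt u U hU) = F.classAtAny u U hU k :=
  (F.existsUnique_tateClassAt u U hU).exists.choose_spec k

/-- Uniqueness: a class with the reductions `c_{U,k}` IS `w_U` (separatedness of `H¹(U, T_pE)`).
[cite: Rubin2000, App. B Prop. B.2.3] -/
theorem eq_tateClassAt_of_forall_reduceH1PkK_eq (U : Subgroup (absoluteGaloisGroup K)) (hU : ∃ s, F.V s ≤ U)
    {w : H1 (tateRepK E p) U} (hw : ∀ k, reduceH1PkK E p k U w = F.classAtAny u U hU k) : w = F.tateClassAt u U hU :=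
  (F.existsUnique_tateClassAt u U hU).unique hw (F.reduceH1PkK_tateClassAt u U hU)

/-- ★ **Norm compatibility of the `w_U`** (the (Z1) clause of `CM.EllipticZetaBody`): `Cor_{U → U'} w_U = w_{U'}` for open
`U ≤ U'` on the tower — reductions commute with `Cor` (`reduceH1PkK_layerCores`) and `Cor c_{U,k} = c_{U',k}`.
[cite: Kato2004Asterisque, §15.5–15.6 (p. 253)] [cite: NeukirchSchmidtWingberg2008, I §5 Prop. 1.5.3 (iii)] -/
theorem layerCores_tateClassAt {U U' : Subgroup (absoluteGaloisGroup K)} (hUU' : U ≤ U')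
    (hUo : IsOpen (U : Set (absoluteGaloisGroup K))) (hU : ∃ s, F.V s ≤ U) (hU' : ∃ s, F.V s ≤ U') :
    CM.layerCores (tateRepK E p) hUU' hUo (F.tateClassAt u U hU) = F.tateClassAt u U' hU' :=
  F.eq_tateClassAt_of_forall_reduceH1PkK_eq u U' hU' fun k ↦ by
    rw [reduceH1PkK_layerCores, F.reduceH1PkK_tateClassAt, F.layerCores_classAtAny]

/-- ★ **Integrality of the `w_U`** (the (Z2) clause of `CM.EllipticZetaBody`): `w_U ∈ H¹(O_{K̄^U}[1/p], T_pE)` — read on the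
reductions (`mem_integralH1K_iff_forall_reduceH1PkK_mem`). [cite: Kato2004Asterisque, §15.6 (15.6.3) (pp. 253–254)
and §8.2 (pp. 180–181)] -/
theorem tateClassAt_mem_integralH1K (U : Subgroup (absoluteGaloisGroup K)) (hU : ∃ s, F.V s ≤ U) :
    F.tateClassAt u U hU ∈ integralH1K (tateRepK E p) p U :=
  (mem_integralH1K_iff_forall_reduceH1PkK_mem E p U _).mpr fun k ↦ by
    rw [F.reduceH1PkK_tateClassAt]
    exact F.classAtAny_mem_integralH1K u U hU k

/-- **The classes as a total function on subgroups** (`0` off the tower): the `w` argument of `CM.EllipticZetaBody`.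
[cite: Kato2004Asterisque, Prop. 15.9 (p. 258)] -/
def tateClass (U : Subgroup (absoluteGaloisGroup K)) : H1 (tateRepK E p) U :=
  haveI := Classical.propDecidable (∃ s, F.V s ≤ U)
  if hU : ∃ s, F.V s ≤ U then F.tateClassAt u U hU else 0

/-- On the tower `tateClass U = w_U`. [cite: Kato2004Asterisque, Prop. 15.9 (p. 258)] -/
theorem tateClass_of_le (U : Subgroup (absoluteGaloisGroup K)) (hU : ∃ s, F.V s ≤ U) :
    F.tateClass u U = F.tateClassAt u U hU := by
  rw [tateClass]
  exact dif_pos hU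

/-- Norm compatibility of `tateClass` on the tower. [cite: Kato2004Asterisque, §15.5–15.6 (p. 253)] -/
theorem layerCores_tateClass {U U' : Subgroup (absoluteGaloisGroup K)} (hUU' : U ≤ U')
    (hUo : IsOpen (U : Set (absoluteGaloisGroup K))) (hU : ∃ s, F.V s ≤ U) :
    CM.layerCores (tateRepK E p) hUU' hUo (F.tateClass u U) = F.tateClass u U' := by
  have hU' : ∃ s, F.V s ≤ U' := hU.imp fun s hs ↦ hs.trans hUU'
  rw [F.tateClass_of_le u U hU, F.tateClass_of_le u U' hU', F.layerCores_tateClassAt]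

/-- Integrality of `tateClass` on the tower. [cite: Kato2004Asterisque, §15.6 (15.6.3) (pp. 253–254)] -/
theorem tateClass_mem_integralH1K (U : Subgroup (absoluteGaloisGroup K)) (hU : ∃ s, F.V s ≤ U) :
    F.tateClass u U ∈ integralH1K (tateRepK E p) p U := by
  rw [F.tateClass_of_le u U hU]
  exact F.tateClassAt_mem_integralH1K u U hU

/-! ## §3 The Λ-adic class and its layer components -/

section Iwasawa

variable (κ : ZpExtension K p) (hV : ∀ n, F.V (n + 1) ≤ κ.layerSubgroup n) {γ : absoluteGaloisGroup K}
  (IK : IwasawaH1DataOver E p κ γ)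

/-- ★ **The Λ-adic class `𝐳 ∈ 𝐇¹_{K,Γ}(T_pE)` of the unit tower** (the unique element of `existsUnique_iwasawaClass`; at the
consumer, `p = 7`, `K = ℚ(√−7)`, `z s = _𝔞z_{7^s𝔣}`: the class `euK 𝔞` of `GenusSeven.PinnedKatoGenusFrame`).
[cite: Kato2004Asterisque, (15.12.1) (p. 263) and 15.14 (p. 264)] -/
def iwasawaClass : IK.H :=
  (F.existsUnique_iwasawaClass u κ hV IK).exists.choose

/-- The defining property: `red_{p^k}(proj_n 𝐳) = c_{n,k}`. [cite: Kato2004Asterisque, §8.2 (p. 181) and §12.2 (p. 220)] -/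
theorem reduceH1PkK_proj_iwasawaClass (n k : ℕ) :
    reduceH1PkK E p k (κ.layerSubgroup n) (IK.proj n (F.iwasawaClass u κ hV IK)) = F.cycClass u κ hV n k :=
  (F.existsUnique_iwasawaClass u κ hV IK).exists.choose_spec n k

/-- Uniqueness: an element of `IK.H` with the reductions `c_{n,k}` IS `𝐳`. [cite: Rubin2000, App. B Prop. B.2.3, §B.3] -/
theorem eq_iwasawaClass {x : IK.H} (hx : ∀ n k, reduceH1PkK E p k (κ.layerSubgroup n) (IK.proj n x) = F.cycClass u κ hV n k) :
    x = F.iwasawaClass u κ hV IK :=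
  (F.existsUnique_iwasawaClass u κ hV IK).unique hx (F.reduceH1PkK_proj_iwasawaClass u κ hV IK)

/-- ★★ **The layer components of `𝐳` are the `T_pE`-adic classes of the layers**: `IK.proj n 𝐳 = w_{Gal(K̄/K_n)}` — the shape
of the field `euK_spec` of `GenusSeven.PinnedKatoGenusFrame` («`IK.proj n (euK 𝔟) = w (Gal(K̄/Kℚ_n))`»).
[cite: Kato2004Asterisque, §12.2 (p. 220) and 15.14 (p. 264)] [cite: Rubin2000, App. B §B.3] -/
theorem proj_iwasawaClass (n : ℕ) :
    IK.proj n (F.iwasawaClass u κ hV IK) = F.tateClassAt u (κ.layerSubgroup n) ⟨n + 1, hV n⟩ :=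
  F.eq_tateClassAt_of_forall_reduceH1PkK_eq u _ _ fun k ↦ by
    rw [F.reduceH1PkK_proj_iwasawaClass, cycClass, F.classAtAny_eq_classAt]

/-- `IK.proj n 𝐳 = tateClass (Gal(K̄/K_n))`. [cite: Kato2004Asterisque, §12.2 (p. 220) and 15.14 (p. 264)] -/
theorem proj_iwasawaClass_eq_tateClass (n : ℕ) :
    IK.proj n (F.iwasawaClass u κ hV IK) = F.tateClass u (κ.layerSubgroup n) := by
  rw [F.tateClass_of_le u _ ⟨n + 1, hV n⟩, F.proj_iwasawaClass]

end Iwasawa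

end KummerFrame

/-! ## §4 The `π`-divisibility test: `(φ|E[p^k])_* ∘ red_{p^k} ∘ φ_* = 0` when `φ ∘ φ = [m]`, `p^k ∣ m` -/

section Isogeny

variable {K : Type} [Field K] {E : WeierstrassCurve K} (p k : ℕ) [Fact p.Prime] [ContinuousSMul ℤ_[p] (E.tateModule p)]

omit [Fact p.Prime] [ContinuousSMul ℤ_[p] (E.tateModule p)] in
/-- For `φ ∘ φ = [m]` and `p^k ∣ m`, any lift `g` of `φ` to `E[p^k]` squares to zero. [cite: SilvermanAEC2009,
III.6.1 and III.7.4] -/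
theorem isogenyTorsion_comp_self_eq_zero (φ : WeierstrassCurve.Isogeny E E) {m : ℤ} (hφ : ∀ P, φ (φ P) = m • P)
    (hm : ((p : ℤ) ^ k) ∣ m) (g : geomTorsion E ((p : ℤ) ^ k) →+ geomTorsion E ((p : ℤ) ^ k))
    (hg : ∀ P, ((g P : geomTorsion E ((p : ℤ) ^ k)) : geomPoints E) = φ (P : geomPoints E)) (P : geomTorsion E ((p : ℤ) ^ k)) :
    g (g P) = 0 := by
  apply Subtype.ext
  obtain ⟨q, rfl⟩ := hm
  rw [hg, hg, hφ, ZeroMemClass.coe_zero, mul_comm, mul_zsmul, (Submodule.mem_torsionBy_iff (R := ℤ) _ _).mp P.2,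
    zsmul_zero]

/-- ★ **`(φ|E[p^k])_* (red_{p^k} (φ_* c)) = 0`** for a `K`-isogeny `φ : E → E` with `φ ∘ φ = [m]`, `p^k ∣ m`, and any
additive lift
`g` of `φ` to `E[p^k]` (`reduceH1PkK` commutes with `φ_*`, `mapH1AddHom_reduceH1PkK_isogeny`, and `g ∘ g = 0`).  At the
consumer: `φ = √−7` on `W_K`, `m = −7`, `p^k = 7`: the reduction-then-`π` of a `π`-multiple vanishes.
[cite: Kato2004Asterisque, 15.14 (p. 264)] [cite: SilvermanAEC2009, III.6.1 and III.7.4] -/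
theorem mapH1AddHom_reduceH1PkK_isogenyLayerMapK_eq_zero (φ : WeierstrassCurve.Isogeny E E) {m : ℤ}
    (hφ : ∀ P, φ (φ P) = m • P) (hm : ((p : ℤ) ^ k) ∣ m)
    (g : geomTorsion E ((p : ℤ) ^ k) →+ geomTorsion E ((p : ℤ) ^ k))
    (hg : ∀ P, ((g P : geomTorsion E ((p : ℤ) ^ k)) : geomPoints E) = φ (P : geomPoints E))
    (U : Subgroup (absoluteGaloisGroup K)) (c : H1 (tateRepK E p) U) :
    mapH1AddHom (subgroupRep (E.torsionGaloisModule ((p : ℤ) ^ k)).toTopRep U)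
        (subgroupRep (E.torsionGaloisModule ((p : ℤ) ^ k)).toTopRep U) g continuous_of_discreteTopology
        (isogenyTorsion_subgroupRepK p k φ g hg U) (reduceH1PkK E p k U (isogenyLayerMapK p φ U c)) = 0 := by
  rw [← mapH1AddHom_reduceH1PkK_isogeny p k φ g hg U c]
  obtain ⟨ψ, hψ⟩ := oneCocycleClass_surjective _ (reduceH1PkK E p k U c)
  rw [← hψ, mapH1AddHom_oneCocycleClass, mapH1AddHom_oneCocycleClass, ← oneCocycleClass_zero]
  refine congrArg _ (Subtype.ext (ContinuousMap.ext fun x ↦ ?_))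
  rw [contOneCocycles.pushAddHom_apply, contOneCocycles.pushAddHom_apply,
    isogenyTorsion_comp_self_eq_zero p k φ hφ hm g hg]
  rfl

variable {p k} {κ : ZpExtension K p} {γ : absoluteGaloisGroup K}

/-- ★★ **The `π`-divisibility test on the pinned Iwasawa cohomology**: for a `K`-isogeny `φ : E → E` with `φ ∘ φ = [m]`,
`p^k ∣ m`, an additive lift `g` of `φ` to `E[p^k]`, and `x ∈ 𝐇¹_{K,Γ}(T_pE)`: if `g_*(red_{p^k}(proj_n x)) ≠ 0` for some `n`,
then `x` is NOT in the image of `φ_* = IK.isogenyMap φ` (`proj_n ∘ φ_* = φ_* ∘ proj_n`, `proj_isogenyMap`).  This is the exact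
shape `euK 𝔞 ∉ Set.range (IK.isogenyMap φ IK hγK)` in which `GenusSeven.PinnedKatoGenusFrame` reads the field
`EU_not_mem_of_residue`; the non-vanishing input is the value side (Prop. 15.9 / (15.12.2)).
[cite: Kato2004Asterisque, 15.14 (p. 264) and (15.12.2) (p. 263)] [cite: SilvermanAEC2009, III.6.1 and III.7.4] -/
theorem not_mem_range_isogenyMap_of_ne_zero (IK : IwasawaH1DataOver E p κ γ) (hγ : κ.IsTopGenerator γ)
    (φ : WeierstrassCurve.Isogeny E E) {m : ℤ} (hφ : ∀ P, φ (φ P) = m • P) (hm : ((p : ℤ) ^ k) ∣ m)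
    (g : geomTorsion E ((p : ℤ) ^ k) →+ geomTorsion E ((p : ℤ) ^ k))
    (hg : ∀ P, ((g P : geomTorsion E ((p : ℤ) ^ k)) : geomPoints E) = φ (P : geomPoints E)) (x : IK.H) (n : ℕ)
    (hx : mapH1AddHom (subgroupRep (E.torsionGaloisModule ((p : ℤ) ^ k)).toTopRep (κ.layerSubgroup n))
        (subgroupRep (E.torsionGaloisModule ((p : ℤ) ^ k)).toTopRep (κ.layerSubgroup n)) g continuous_of_discreteTopology
        (isogenyTorsion_subgroupRepK p k φ g hg (κ.layerSubgroup n)) (reduceH1PkK E p k (κ.layerSubgroup n) (IK.proj n x)) ≠ 0) :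
    x ∉ Set.range (IK.isogenyMap φ IK hγ) := by
  rintro ⟨x', rfl⟩
  apply hx
  rw [IwasawaH1DataOver.proj_isogenyMap]
  exact mapH1AddHom_reduceH1PkK_isogenyLayerMapK_eq_zero p k φ hφ hm g hg _ _

end Isogeny

end Literature.NumberTheory.EllipticCurves.Kato2004

end
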